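import Summits.CriticalPhenomena.PercolationContinuityZ3.Theorems.Transplant.SkelFrmQuasi1ParamsPO
import Summits.CriticalPhenomena.PercolationContinuityZ3.Theorems.Transplant.SkelFrm1ParamsPO
import Summits.CriticalPhenomena.PercolationContinuityZ3.Theorems.Transplant.SkelNeg1ParamsO
import Summits.CriticalPhenomena.PercolationContinuityZ3.Theorems.Transplant.SkelNegParamsLatticeInv
import Summits.CriticalPhenomena.PercolationContinuityZ3.Theorems.Transplant.SkelNegParamsFineMult
import Summits.CriticalPhenomena.PercolationContinuityZ3.Theorems.Transplant.SkelNeg1ParamsL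
import Summits.CriticalPhenomena.PercolationContinuityZ3.Theorems.Transplant.PlanarSkeletonFrmQuasiDefs
import Summits.CriticalPhenomena.PercolationContinuityZ3.Theorems.Transplant.PlanarSkeletonFrmDefs
import Summits.CriticalPhenomena.PercolationContinuityZ3.Theorems.Transplant.SkelPhiStepIDataNS
import Summits.CriticalPhenomena.PercolationContinuityZ3.Theorems.Transplant.SkelNegBParamsL
import Summits.CriticalPhenomena.PercolationContinuityZ3.Theorems.Transplant.SkelFrmFrom1ParamsLBL
import HarnessLib
import Summits.CriticalPhenomena.PercolationContinuityZ3.Theorems.Transplant.SkelFrm1ParamsLBL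
/-!
# GEN-Q PORT (WAVE-Q table v0.8 section 2, row G008, U-level L2; captain R-6/R-7 2026-08-27: carrier token swap `PlanarSkeletonFrmFrom ↦ PlanarSkeletonFrmQuasi`)
# of the tree module «Transplant/SkelFrmFrom1ParamsLBL» (sha256 85f77ff5b7aec2f1…) onto the quasi-step carrier `PlanarSkeletonFrmQuasi` (p507026): «SkelFrmQuasi1ParamsLBL»

ORIGINAL TITLE: N2 (frames-only node `SamePDropOfSkeletonFrm₁`, OPEN) params column over `PlanarSkeletonFrm` — (ζ″) ledger, shape (B′) of record ((R-14)):

builds on p205010 (kernel theorem, internal audit signed; external expert review pending) — nothing in this file uses p205010; NOTHING is claimed about any open node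
((N3-b), the end state).  Lane `prim-bschramm`, seat `prim-bschramm-gen-1` (gen 4; binder-wave captain).  Helper file (`--supports stmt-CriticalPhenomena-4575 --as helper`).
PORT RULES (U-wave r1–r4 re-used, GEN-Q hunk classes of p3-g29 #6136): declaration order, names and proof texts are those of «SkelFrmFrom1ParamsLBL», byte-identical except
(i) the carrier token `PlanarSkeletonFrmFrom ↦ PlanarSkeletonFrmQuasi` in binders, `namespace`/`end` lines and qualified names (module names `SkelFrmFrom… ↦ SkelFrmQuasi…`
in imports of already-ported rows); (ii) `Φ.step ↦ Φ.qstep` with the called Steps lemma replaced by its `…Q`/`_q` twin and the cost `Φ.M` threaded (none in this file unless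
listed below); (iii) `Φ.cyl_connected ↦ Φ.cyl_reach` readers (none unless listed); (iv) graph-ball radii / window floors ×`Φ.M` (none unless listed).  Carrier-free
residents stay imported/exported from the original «SkelFrm1ParamsLBL» exactly as in the FrmFrom port.  Docstrings and citations are the original's.

-/

noncomputable section

open scoped Classical

namespace Summit.CriticalPhenomena.PercolationContinuityZ3.Theorems.Transplant

namespace PlanarSkeletonFrmQuasi

namespace Neg

open Literature.Probability.Percolation Literature.Probability.LatticeModels SimpleGraph
open SkelConc (Consts)

section LLevel

/-! ## §1 The values -/

-- GEN-Q (R-2, captain 2026-08-27): `PlanarSkeletonFrmFrom.Neg.nL` is not in the used cone of the node top — not ported.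

-- GEN-Q (R-2, captain 2026-08-27): `PlanarSkeletonFrmFrom.Neg.hL` is not in the used cone of the node top — not ported.

-- GEN-Q (R-2, captain 2026-08-27): `PlanarSkeletonFrmFrom.Neg.ℓL` is not in the used cone of the node top — not ported.

-- GEN-Q (R-2, captain 2026-08-27): `PlanarSkeletonFrmFrom.Neg.vL` is not in the used cone of the node top — not ported.

-- GEN-Q (R-2, captain 2026-08-27): `PlanarSkeletonFrmFrom.Neg.vβL` is not in the used cone of the node top — not ported.

-- GEN-Q (R-2, captain 2026-08-27): `PlanarSkeletonFrmFrom.Neg.coarse` is not in the used cone of the node top — not ported.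

-- GEN-Q (R-2, captain 2026-08-27): `PlanarSkeletonFrmFrom.Neg.m0` is not in the used cone of the node top — not ported.

-- GEN-Q (R-2, captain 2026-08-27): `PlanarSkeletonFrmFrom.Neg.m1` is not in the used cone of the node top — not ported.

-- GEN-Q (R-2, captain 2026-08-27): `PlanarSkeletonFrmFrom.Neg.mNat` is not in the used cone of the node top — not ported.

-- GEN-Q (R-2, captain 2026-08-27): `PlanarSkeletonFrmFrom.Neg.cellsF` is not in the used cone of the node top — not ported.

export PlanarSkeletonFrmFrom.Neg (Sz)

-- GEN-Q (R-2, captain 2026-08-27): `PlanarSkeletonFrmFrom.Neg.SMn` is not in the used cone of the node top — not ported.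

export PlanarSkeletonNeg.Neg (m₀)

/-! ## §2 The facts by name -/

-- GEN-Q (R-2, captain 2026-08-27): `PlanarSkeletonFrmFrom.Neg.n₁L_le_nL` is not in the used cone of the node top — not ported.

-- GEN-Q (R-2, captain 2026-08-27): `PlanarSkeletonFrmFrom.Neg.ML_lt_nL` is not in the used cone of the node top — not ported.

-- GEN-Q (R-2, captain 2026-08-27): `PlanarSkeletonFrmFrom.Neg.nS_lt_nL` is not in the used cone of the node top — not ported.

-- GEN-Q (R-2, captain 2026-08-27): `PlanarSkeletonFrmFrom.Neg.mem_SMn` is not in the used cone of the node top — not ported.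

export PlanarSkeletonFrmFrom.Neg (Sz_adm)

export PlanarSkeletonFrmFrom.Neg (Mu_mem_Sz)

-- GEN-Q (R-2, captain 2026-08-27): `PlanarSkeletonFrmFrom.Neg.SMn_adm_at` is not in the used cone of the node top — not ported.

export PlanarSkeletonNeg.Neg (m₀_eq)

-- GEN-Q (R-2, captain 2026-08-27): `PlanarSkeletonFrmFrom.Neg.eqGeom_facts_of` is not in the used cone of the node top — not ported.

-- GEN-Q (R-2, captain 2026-08-27): `PlanarSkeletonFrmFrom.Neg.eqGeomL_facts` is not in the used cone of the node top — not ported.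

-- GEN-Q (R-2, captain 2026-08-27): `PlanarSkeletonFrmFrom.Neg.lip_coarse_at` is not in the used cone of the node top — not ported.

-- GEN-Q (R-2, captain 2026-08-27): `PlanarSkeletonFrmFrom.Neg.coarse_drift_at` is not in the used cone of the node top — not ported.

-- GEN-Q (R-2, captain 2026-08-27): `PlanarSkeletonFrmFrom.Neg.exists_coarse_eq_at` is not in the used cone of the node top — not ported.

-- GEN-Q (R-2, captain 2026-08-27): `PlanarSkeletonFrmFrom.Neg.φ_extent_at` is not in the used cone of the node top — not ported.

-- GEN-Q (R-2, captain 2026-08-27): `PlanarSkeletonFrmFrom.Neg.R'_le_m_at` is not in the used cone of the node top — not ported.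

-- GEN-Q (R-2, captain 2026-08-27): `PlanarSkeletonFrmFrom.Neg.one_le_m_at` is not in the used cone of the node top — not ported.

-- GEN-Q (R-2, captain 2026-08-27): `PlanarSkeletonFrmFrom.Neg.cellsF_s_at` is not in the used cone of the node top — not ported.

-- GEN-Q (R-2, captain 2026-08-27): `PlanarSkeletonFrmFrom.Neg.cellsF_K` is not in the used cone of the node top — not ported.

-- GEN-Q (R-2, captain 2026-08-27): `PlanarSkeletonFrmFrom.Neg.cL_le_D_at` is not in the used cone of the node top — not ported.

end LLevel

end Neg

end PlanarSkeletonFrmQuasi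

end Summit.CriticalPhenomena.PercolationContinuityZ3.Theorems.Transplant

end

/-!
# N2 (frames-only node `SamePDropOfSkeletonFrm₁`, OPEN) params column over `PlanarSkeletonFrm` — (ζ″) ledger, shape (B′) of record ((R-14)):
# MECHANICAL PORT of N1's `SkelNegBParamsL` — chain of record `NegB` (the `Neg` chain RE-VERSIONED ONCE with a BOX slot), part L: the long box **`NegB.ML κ Φ t p D g := max
# (Neg.ML …) g`**, the long width `NegB.nL κ Φ t p D g f`, the long data `hL/ℓL/vL/vβL`, the multipliers `m0/m1`, the pair list `SMn g f` — every landed floor of `Neg.ML` …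
# (N1 title abridged; see `SkelNegBParamsL`)
builds on p205010 (kernel theorem, internal audit signed; external expert review pending) — nothing in this file uses p205010; NOTHING is claimed about the
open node `SamePDropOfSkeletonFrm₁` (`SamePDropOfSkeletonNeg₁` is CLOSED in the tree and untouched by this file).
Status sentence (coordinator 2026-08-20T04:30Z): "θ(p_c) = 0 on ℤ^d, all d ≥ 2 — kernel-verified (Lean 4/Mathlib, standard axioms); internal adversarial
audit SIGNED 2026-08-20 04:29Z; external expert review pending."
Lane `prim-bschramm-*`, seat `prim-bschramm-stmt` (gen 19); helper file (`--supports stmt-CriticalPhenomena-4575 --as helper`); ledger HOME/prim-bschramm-stmt/FRM-PARAMS.md §9, (R-14).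
PORT RULES (HOME/prim-bschramm-stmt-g19/lean/port_frm.py, the tool of record per (R-14)): outer namespace `PlanarSkeletonNeg ↦ PlanarSkeletonFrm`, carrier binder
`(Φ : PlanarSkeletonFrmQuasi G)`, record binder `(D : Skelφ.StepI.DataNS V)` (the selectors travel IN the record, `SkelPhiStepIDataNS`); section variables INLINED into every
declaration header; inner namespaces (`Neg`/`NegB`/`KS`/…) and every short name KEPT so all cross-references resolve unchanged; declarations using no section variable are
NOT re-declared (N1's originals are referenced fully qualified). Mathematical content, proofs, docstrings and citations are N1's, verbatim, except where stated next.
SELECTORS IN THIS FILE ((R-14) condition of record — joint selection, `D.sN`'s first argument is the literal handed to `D.sM`): LONG pair `ML g := D.sM (max (Neg.ML …) g)`, `nL g f := D.sN (max (Neg.ML …) g) (NegPrm.nL (max (n₁ M_L) f) M_L K R′)` (zone floor `max (Neg.ML …) g` in BOTH selectors; slots `g f` keep their N1 meaning); `long_pair_eq` by rfl; `ML_le_ML/n₁L_le_nL/ML_lt_nL` gain one `le_sM/le_sN` step.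
N1 HEADER (kept for the reader):
helper file (`--supports stmt-CriticalPhenomena-4575 --as helper`); ledger HOME/prim-bschramm-stmt/NEG-PARAMS.md v0.10.
WHY THE RE-VERSION (located, stmt-g13 2026-08-21T15:45:24Z): the (R) ruling N1-R-PLAN v2 / B.13 (p3-g9 15:38:39Z) adds a third Step-I″ pair `(M_b, n_b)` (the BRIDGE) chosen AFTER the kit
block, and the long box must dominate the bridge parallelogram: `M_L + 1 ≥ 2C′(n_b + ℓ_b + |h_b|) + 1` — a BOX floor with data the landed `Neg.ML` (short data only, no slot) cannot see.
So the chain of record is re-typed in the namespace `NegB` with TWO slots: `g` (extra BOX floors: the bridge's, the kit layer's) and `f` (extra WIDTH floors: (R-F1)_b, `C_run·R′`);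
every value and fact holds for EVERY `(g, f)`, and the ledger closes both slots at the end (`NegB.gR`, `NegB.fR`).  The `Neg` one-slot chain (p277618 …) stays as the `g = 0` reading.
Names: the SAME short names as `Neg` (`ML nL hL ℓL vL vβL m0 m1 SMn …`), one more argument `g`; the zone scale / short pair / kit block (`Mu ρz nS hS ℓS vS As Mk T₀ … Rlev R'`,
`Sz`, `m₀`) are `Neg`'s unchanged (no box dependence).
* §1 `ML`, `ML_le_ML` (`Neg.ML ≤ ML g`, `g ≤ ML g`), `Mu_le_ML`, `nS_le_ML`, `hop_floor_le_ML`, `slack_floor_le_ML`, `coarse_floor_le_ML`, `kit_floors_ML` (the landed floors, transferred);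
* §2 `nL g f`, `hL/ℓL/vL/vβL/m0/m1`, `SMn g f`; §3 `n₁L_le_nL`, `ML_lt_nL`, `nS_lt_nL`, `mem_SMn`, `SMn_adm_at`.
[cite: KozmaNitzan2024, §4 Theorem 6 (pp. 25–31): the order of constants] [cite: MartineauTassion2017, §3.2 Lemma 3.5, §4.1–4.3]
-/

noncomputable section

open scoped Classical

namespace Summit.CriticalPhenomena.PercolationContinuityZ3.Theorems.Transplant

namespace PlanarSkeletonFrmQuasi

namespace NegB

open Literature.Probability.Percolation Literature.Probability.LatticeModels SimpleGraph
open SkelConc (Consts)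
open Neg

section LLevel

/-! ## §1 The long box with the box slot -/

/-- **THE LONG BOX OF RECORD with floor slot `g`**: `M_L := max (Neg.ML κ Φ t p D) g` (`Neg.ML` = the v0 floors `{M_u, 16(|h_s|+ℓ_s+n_s), 959, 4K(R′+2)}`; `g` = the box floors
posted later: the bridge's `16(n_b + ℓ_b + |h_b|)`, the kit layer's). [this work] -/
def ML (κ : Consts) {V : Type} [DecidableEq V] [Countable V] {G : SimpleGraph V} [G.LocallyFinite] (Φ : PlanarSkeletonFrmQuasi G) (t : V) (p : unitInterval) (D : Skelφ.StepI.DataNS V) (g : ℕ) : ℕ := D.sM (max (Neg.ML κ Φ t p D) g)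

/-- `Neg.ML ≤ M_L` and `g ≤ M_L`. [folklore] -/
theorem ML_le_ML (κ : Consts) {V : Type} [DecidableEq V] [Countable V] {G : SimpleGraph V} [G.LocallyFinite] (Φ : PlanarSkeletonFrmQuasi G) (t : V) (p : unitInterval) (D : Skelφ.StepI.DataNS V) (g : ℕ) : Neg.ML κ Φ t p D ≤ ML κ Φ t p D g ∧ g ≤ ML κ Φ t p D g :=
  ⟨(le_max_left _ _).trans (D.le_sM _), (le_max_right _ _).trans (D.le_sM _)⟩

/-- `M_u ≤ M_L`. [folklore] -/
theorem Mu_le_ML (κ : Consts) {V : Type} [DecidableEq V] [Countable V] {G : SimpleGraph V} [G.LocallyFinite] (Φ : PlanarSkeletonFrmQuasi G) (t : V) (p : unitInterval) (D : Skelφ.StepI.DataNS V) (g : ℕ) : Mu D ≤ ML κ Φ t p D g := (Neg.Mu_le_ML κ Φ t p D).trans (ML_le_ML κ Φ t p D g).1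

-- GEN-Q (R-2, captain 2026-08-27): `PlanarSkeletonFrmFrom.NegB.nS_le_ML` is not in the used cone of the node top — not ported.

-- GEN-Q (R-2, captain 2026-08-27): `PlanarSkeletonFrmFrom.NegB.hop_floor_le_ML` is not in the used cone of the node top — not ported.

/-- The slack floor `960 ≤ M_L + 1`. [folklore] -/
theorem slack_floor_le_ML (κ : Consts) {V : Type} [DecidableEq V] [Countable V] {G : SimpleGraph V} [G.LocallyFinite] (Φ : PlanarSkeletonFrmQuasi G) (t : V) (p : unitInterval) (D : Skelφ.StepI.DataNS V) (g : ℕ) : 960 ≤ ML κ Φ t p D g + 1 := by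
  have h1 := Neg.slack_floor_le_ML κ Φ t p D
  have h2 := (ML_le_ML κ Φ t p D g).1
  omega

/-- The coarse/kit floors `4K(R′+2) ≤ M_L`, `4K ≤ M_L`. [folklore] -/
theorem coarse_floor_le_ML (κ : Consts) {V : Type} [DecidableEq V] [Countable V] {G : SimpleGraph V} [G.LocallyFinite] (Φ : PlanarSkeletonFrmQuasi G) (t : V) (p : unitInterval) (D : Skelφ.StepI.DataNS V) (g : ℕ) : 4 * Neg.K κ * (R' κ Φ t p D + 2) ≤ ML κ Φ t p D g ∧ 4 * Neg.K κ ≤ ML κ Φ t p D g :=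
  ⟨(Neg.coarse_floor_le_ML κ Φ t p D).1.trans (ML_le_ML κ Φ t p D g).1, (Neg.coarse_floor_le_ML κ Φ t p D).2.trans (ML_le_ML κ Φ t p D g).1⟩

-- GEN-Q (R-2, captain 2026-08-27): `PlanarSkeletonFrmFrom.NegB.kit_floors_ML` is not in the used cone of the node top — not ported.

/-! ## §2 The long width, data, multipliers, list -/

/-- **The long width with box slot `g` and clearance slot `f`**: `n_L := max {D.n₁ M_L, f, M_L + 1, K(R′+2)}`. [this work] -/
def nL (κ : Consts) {V : Type} [DecidableEq V] [Countable V] {G : SimpleGraph V} [G.LocallyFinite] (Φ : PlanarSkeletonFrmQuasi G) (t : V) (p : unitInterval) (D : Skelφ.StepI.DataNS V) (g : ℕ) (f : ℕ) : ℕ := D.sN (max (Neg.ML κ Φ t p D) g) (Skelφ.NegPrm.nL (max (D.n₁ (ML κ Φ t p D g)) f) (ML κ Φ t p D g) (Neg.K κ) (R' κ Φ t p D))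

/-- The long shear `h_L := D.hgt t M_L n_L`. [this work] -/
def hL (κ : Consts) {V : Type} [DecidableEq V] [Countable V] {G : SimpleGraph V} [G.LocallyFinite] (Φ : PlanarSkeletonFrmQuasi G) (t : V) (p : unitInterval) (D : Skelφ.StepI.DataNS V) (g : ℕ) (f : ℕ) : ℤ := D.hgt t (ML κ Φ t p D g) (nL κ Φ t p D g f)

/-- The long half-length `ℓ_L := D.len t M_L n_L`. [this work] -/
def ℓL (κ : Consts) {V : Type} [DecidableEq V] [Countable V] {G : SimpleGraph V} [G.LocallyFinite] (Φ : PlanarSkeletonFrmQuasi G) (t : V) (p : unitInterval) (D : Skelφ.StepI.DataNS V) (g : ℕ) (f : ℕ) : ℕ := D.len t (ML κ Φ t p D g) (nL κ Φ t p D g f)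

/-- The long split point `v_L := D.spl t M_L n_L`. [this work] -/
def vL (κ : Consts) {V : Type} [DecidableEq V] [Countable V] {G : SimpleGraph V} [G.LocallyFinite] (Φ : PlanarSkeletonFrmQuasi G) (t : V) (p : unitInterval) (D : Skelφ.StepI.DataNS V) (g : ℕ) (f : ℕ) : ℤ := D.spl t (ML κ Φ t p D g) (nL κ Φ t p D g f)

/-- The second lattice vector's height `v_β := vβOf n_L h_L ℓ_L v_L`. [this work] -/
def vβL (κ : Consts) {V : Type} [DecidableEq V] [Countable V] {G : SimpleGraph V} [G.LocallyFinite] (Φ : PlanarSkeletonFrmQuasi G) (t : V) (p : unitInterval) (D : Skelφ.StepI.DataNS V) (g : ℕ) (f : ℕ) : ℤ := Skelφ.NegPrm.vβOf (nL κ Φ t p D g f) (hL κ Φ t p D g f) (ℓL κ Φ t p D g f) (vL κ Φ t p D g f)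

-- GEN-Q (R-2, captain 2026-08-27): `PlanarSkeletonFrmFrom.NegB.m0` is not in the used cone of the node top — not ported.

-- GEN-Q (R-2, captain 2026-08-27): `PlanarSkeletonFrmFrom.NegB.m1` is not in the used cone of the node top — not ported.

/-- **The two ledger pairs** `SMn := {(M_u, n_s), (M_L, n_L)}`. [this work] -/
def SMn (κ : Consts) {V : Type} [DecidableEq V] [Countable V] {G : SimpleGraph V} [G.LocallyFinite] (Φ : PlanarSkeletonFrmQuasi G) (t : V) (p : unitInterval) (D : Skelφ.StepI.DataNS V) (g : ℕ) (f : ℕ) : Finset (ℕ × ℕ) := Skelφ.NegPrm.SMn (Mu D) (nS D) (ML κ Φ t p D g) (nL κ Φ t p D g f)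

/-- **The long pair IS the selected pair** at zone floor `max (Neg.ML …) g` and width floor `NegPrm.nL (max (n₁ M_L) f) M_L K R′` (by `rfl`). [folklore] -/
theorem long_pair_eq (κ : Consts) {V : Type} [DecidableEq V] [Countable V] {G : SimpleGraph V} [G.LocallyFinite] (Φ : PlanarSkeletonFrmQuasi G) (t : V) (p : unitInterval) (D : Skelφ.StepI.DataNS V) (g : ℕ) (f : ℕ) :
    ML κ Φ t p D g = D.sM (max (Neg.ML κ Φ t p D) g) ∧
      nL κ Φ t p D g f = D.sN (max (Neg.ML κ Φ t p D) g) (Skelφ.NegPrm.nL (max (D.n₁ (ML κ Φ t p D g)) f) (ML κ Φ t p D g) (Neg.K κ) (R' κ Φ t p D)) :=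
  ⟨rfl, rfl⟩

/-! ## §3 The facts by name -/

/-- `D.n₁ M_L ≤ n_L` and `f ≤ n_L`. [folklore] -/
theorem n₁L_le_nL (κ : Consts) {V : Type} [DecidableEq V] [Countable V] {G : SimpleGraph V} [G.LocallyFinite] (Φ : PlanarSkeletonFrmQuasi G) (t : V) (p : unitInterval) (D : Skelφ.StepI.DataNS V) (g : ℕ) (f : ℕ) : D.n₁ (ML κ Φ t p D g) ≤ nL κ Φ t p D g f ∧ f ≤ nL κ Φ t p D g f :=
  ⟨(Skelφ.NegPrm.rootClear_le_nL _ f _ _ _).1.trans (D.le_sN _ _), (Skelφ.NegPrm.rootClear_le_nL _ f _ _ _).2.trans (D.le_sN _ _)⟩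

/-- `M_L < n_L` and `K(R′+2) ≤ n_L`. [folklore] -/
theorem ML_lt_nL (κ : Consts) {V : Type} [DecidableEq V] [Countable V] {G : SimpleGraph V} [G.LocallyFinite] (Φ : PlanarSkeletonFrmQuasi G) (t : V) (p : unitInterval) (D : Skelφ.StepI.DataNS V) (g : ℕ) (f : ℕ) : ML κ Φ t p D g < nL κ Φ t p D g f ∧ Neg.K κ * (R' κ Φ t p D + 2) ≤ nL κ Φ t p D g f :=
  ⟨(Skelφ.NegPrm.ML_lt_nL _ _ _ _).trans_le (D.le_sN _ _), (Skelφ.NegPrm.coarse_floor_le_nL _ _ _ _).trans (D.le_sN _ _)⟩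

-- GEN-Q (R-2, captain 2026-08-27): `PlanarSkeletonFrmFrom.NegB.nS_lt_nL` is not in the used cone of the node top — not ported.

/-- The two pairs are listed. [folklore] -/
theorem mem_SMn (κ : Consts) {V : Type} [DecidableEq V] [Countable V] {G : SimpleGraph V} [G.LocallyFinite] (Φ : PlanarSkeletonFrmQuasi G) (t : V) (p : unitInterval) (D : Skelφ.StepI.DataNS V) (g : ℕ) (f : ℕ) : (Mu D, nS D) ∈ SMn κ Φ t p D g f ∧ (ML κ Φ t p D g, nL κ Φ t p D g f) ∈ SMn κ Φ t p D g f :=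
  ⟨Skelφ.NegPrm.short_mem_SMn _ _ _ _, Skelφ.NegPrm.long_mem_SMn _ _ _ _⟩

/-- **Pair admissibility**: `∀ q ∈ SMn, D.M₀ ≤ q.1 ∧ D.n₁ q.1 ≤ q.2` — for every `(g, f)`. [folklore] -/
theorem SMn_adm_at (κ : Consts) {V : Type} [DecidableEq V] [Countable V] {G : SimpleGraph V} [G.LocallyFinite] (Φ : PlanarSkeletonFrmQuasi G) (t : V) (p : unitInterval) (D : Skelφ.StepI.DataNS V) (g : ℕ) (f : ℕ) : ∀ q ∈ SMn κ Φ t p D g f, D.M₀ ≤ q.1 ∧ D.n₁ q.1 ≤ q.2 :=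
  Skelφ.NegPrm.SMn_adm (M₀_le_Mu D) (n₁_le_nS D) ((M₀_le_Mu D).trans (Mu_le_ML κ Φ t p D g)) (n₁L_le_nL κ Φ t p D g f).1

end LLevel

end NegB

end PlanarSkeletonFrmQuasi

end Summit.CriticalPhenomena.PercolationContinuityZ3.Theorems.Transplant

end
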